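import Summits.Ventures.PercRepro.BlockSum

/-!
# PercRepro — the cycle matroid `M(K₄)` on `Fin 6` and its rank table (p9, gen 14)

`proofs/P9-S4-LINELADDER-g13.md` §8: the block of the K₄ family. The six edges of `K₄` on the vertices `0, 1, 2, 3` are
numbered `0 = 01, 1 = 02, 2 = 03, 3 = 12, 4 = 13, 5 = 23`; the seven circuits are the four triangles and the three
four-cycles. Independence = «contains no circuit», the rank `rk X` = the largest independent subset of `X`
(a `Finset.sup`), the matroid `K4` is `IndepMatroid.ofFinset` with the augmentation axiom decided in the kernel, and
`eRk_coe : K4.eRk ↑X = rk X`. The profile table `(rk X, rk Xᶜ)` over the 64 edge subsets is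
`(0,3)·1, (1,3)·6, (2,3)·19, (3,3)·12, (3,2)·19, (3,1)·6, (3,0)·1` (`sum_profile`), and `3 ≤ rk X + rk Xᶜ`
(`three_le_rk_add_rk_compl`). Nothing here is about any window of S4.
-/

namespace PercRepro.K4Ladder

open Finset

/-- The seven circuits of `M(K₄)`: the triangles `{01,02,12}`, `{01,03,13}`, `{02,03,23}`, `{12,13,23}` and the
four-cycles `{01,12,23,03}`, `{01,13,23,02}`, `{02,12,13,03}`. -/
def circuits : Finset (Finset (Fin 6)) :=
  {{0, 1, 3}, {0, 2, 4}, {1, 2, 5}, {3, 4, 5}, {0, 2, 3, 5}, {0, 1, 4, 5}, {1, 2, 3, 4}}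

/-- An edge set is independent (a forest) iff it contains no circuit. -/
def indepF (I : Finset (Fin 6)) : Prop := ∀ C ∈ circuits, ¬ C ⊆ I

/-- `indepF` is decidable (a bounded check over the seven circuits); the kernel computes with it. -/
instance indepF_decidable : DecidablePred indepF := fun I => by unfold indepF; infer_instance

/-- The rank of an edge set: the largest size of an independent subset. -/
def rk (X : Finset (Fin 6)) : ℕ := (X.powerset.filter indepF).sup Finset.card

/-- The profile of an edge set: `(rk X, rk Xᶜ)`. -/
def profile (X : Finset (Fin 6)) : ℕ × ℕ := (rk X, rk Xᶜ)

/-- The empty edge set is a forest. -/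
theorem indepF_empty : indepF ∅ := by decide

/-- A subset of a forest is a forest. -/
theorem indepF_subset {I J : Finset (Fin 6)} (hJ : indepF J) (hIJ : I ⊆ J) : indepF I :=
  fun C hC hCI => hJ C hC (hCI.trans hIJ)

/-- The augmentation axiom for the forests of `K₄`, decided in the kernel over the `64 × 64` pairs of edge sets. -/
theorem indepF_aug : ∀ I J : Finset (Fin 6), indepF I → indepF J → I.card < J.card →
    ∃ e ∈ J, e ∉ I ∧ indepF (insert e I) := by
  decide +kernel

/-- `3 ≤ rk X + rk Xᶜ` for every edge set (every profile of `M(K₄)` has `k₁ + k₂ ≥ 3`). -/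
theorem three_le_rk_add_rk_compl : ∀ X : Finset (Fin 6), 3 ≤ rk X + rk Xᶜ := by
  decide +kernel

/-- The seven profiles of `M(K₄)`. -/
theorem image_profile : (univ : Finset (Finset (Fin 6))).image profile
    = {(0, 3), (1, 3), (2, 3), (3, 3), (3, 2), (3, 1), (3, 0)} := by
  decide +kernel

/-- The profile `(0, 3)` has multiplicity `1` (the empty edge set). -/
theorem card_fibre_03 : #{X ∈ (univ : Finset (Finset (Fin 6))) | profile X = (0, 3)} = 1 := by decide +kernel
/-- The profile `(1, 3)` has multiplicity `6` (the single edges). -/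
theorem card_fibre_13 : #{X ∈ (univ : Finset (Finset (Fin 6))) | profile X = (1, 3)} = 6 := by decide +kernel
/-- The profile `(2, 3)` has multiplicity `19` (the 15 pairs and the 4 triangles). -/
theorem card_fibre_23 : #{X ∈ (univ : Finset (Finset (Fin 6))) | profile X = (2, 3)} = 19 := by decide +kernel
/-- The profile `(3, 3)` has multiplicity `12` (the 12 Hamiltonian paths, whose complements are Hamiltonian paths). -/
theorem card_fibre_33 : #{X ∈ (univ : Finset (Finset (Fin 6))) | profile X = (3, 3)} = 12 := by decide +kernel
/-- The profile `(3, 2)` has multiplicity `19` (the 4 stars and the 15 four-edge sets). -/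
theorem card_fibre_32 : #{X ∈ (univ : Finset (Finset (Fin 6))) | profile X = (3, 2)} = 19 := by decide +kernel
/-- The profile `(3, 1)` has multiplicity `6` (the complements of the single edges). -/
theorem card_fibre_31 : #{X ∈ (univ : Finset (Finset (Fin 6))) | profile X = (3, 1)} = 6 := by decide +kernel
/-- The profile `(3, 0)` has multiplicity `1` (the full edge set). -/
theorem card_fibre_30 : #{X ∈ (univ : Finset (Finset (Fin 6))) | profile X = (3, 0)} = 1 := by decide +kernel

/-- **The profile table of `M(K₄)`**: any sum over the 64 edge subsets of a function of the profile `(rk X, rk Xᶜ)`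
is `F(0,3) + 6·F(1,3) + 19·F(2,3) + 12·F(3,3) + 19·F(3,2) + 6·F(3,1) + F(3,0)`. -/
theorem sum_profile (F : ℕ × ℕ → ℕ) :
    ∑ X : Finset (Fin 6), F (profile X)
      = F (0, 3) + 6 * F (1, 3) + 19 * F (2, 3) + 12 * F (3, 3) + 19 * F (3, 2) + 6 * F (3, 1) + F (3, 0) := by
  rw [Finset.sum_comp, image_profile]
  rw [Finset.sum_insert (by decide), Finset.sum_insert (by decide), Finset.sum_insert (by decide),
    Finset.sum_insert (by decide), Finset.sum_insert (by decide), Finset.sum_insert (by decide),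
    Finset.sum_singleton, card_fibre_03, card_fibre_13, card_fibre_23, card_fibre_33, card_fibre_32, card_fibre_31,
    card_fibre_30]
  simp only [smul_eq_mul, one_mul]
  ring

/-! ### The matroid -/

/-- **The cycle matroid `M(K₄)`** on `Fin 6`, from the independence axioms of the forests. -/
def K4 : Matroid (Fin 6) :=
  (IndepMatroid.ofFinset (E := (Set.univ : Set (Fin 6))) indepF indepF_empty
    (fun _ _ hJ hIJ => indepF_subset hJ hIJ) (fun _ _ hI hJ h => indepF_aug _ _ hI hJ h)
    (fun _ _ => Set.subset_univ _)).matroid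

/-- The ground set of `K4` is `Fin 6`. -/
theorem K4_ground : K4.E = Set.univ := rfl

/-- `M(K₄)` is a finite matroid. -/
theorem K4_finite : K4.Finite := ⟨Set.finite_univ⟩

/-- Independence in `K4` is `indepF`. -/
theorem K4_indep_iff (I : Finset (Fin 6)) : K4.Indep ↑I ↔ indepF I := by
  rw [K4, IndepMatroid.matroid_indep_iff, IndepMatroid.ofFinset_indep]

/-- **The rank function of `M(K₄)`** is `rk`. -/
theorem eRk_coe (X : Finset (Fin 6)) : K4.eRk ↑X = (rk X : ℕ∞) := by
  apply le_antisymm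
  · rw [Matroid.eRk_le_iff]
    intro I hIX hI
    obtain ⟨J, rfl⟩ := (Set.toFinite I).exists_finset_coe
    rw [K4_indep_iff] at hI
    rw [Set.encard_coe_eq_coe_finsetCard]
    exact_mod_cast Finset.le_sup (f := Finset.card)
      (Finset.mem_filter.2 ⟨Finset.mem_powerset.2 (Finset.coe_subset.1 hIX), hI⟩)
  · rw [Matroid.le_eRk_iff]
    obtain ⟨J, hJ, hJsup⟩ := Finset.exists_mem_eq_sup (X.powerset.filter indepF)
      ⟨∅, Finset.mem_filter.2 ⟨Finset.mem_powerset.2 (Finset.empty_subset X), indepF_empty⟩⟩ Finset.card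
    rw [Finset.mem_filter, Finset.mem_powerset] at hJ
    exact ⟨↑J, Finset.coe_subset.2 hJ.1, (K4_indep_iff J).2 hJ.2,
      by rw [Set.encard_coe_eq_coe_finsetCard, rk, hJsup]⟩

/-- The rank of the complement of an edge set. -/
theorem eRk_compl_coe (X : Finset (Fin 6)) : K4.eRk (K4.E \ ↑X) = (rk Xᶜ : ℕ∞) := by
  rw [K4_ground, ← Set.compl_eq_univ_sdiff, ← Finset.coe_compl, eRk_coe]

end PercRepro.K4Ladder
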